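import Summits.ResolutionOfSingularities.ResolutionOfSingularities.Theorems.EquisingularLiftEquisingularLiftNatConeRoundCentre
import Summits.ResolutionOfSingularities.ResolutionOfSingularities.Theorems.EquisingularLiftEquisingularLiftNatInCarrierCentre
import Literature.AlgebraicGeometry.Resolution.ComponentGluing
import HarnessLib

/-!
# [OURS · L1 W4.5(b) · EL♮(3)] rung TOWER supplier — THE CONE-ROUND BRICK, clause (4): SHADOW & EXCEPTIONAL TRANSPORT —
# the special-fibre traces of `St 𝒦` and `St 𝓔` through a cone round

Crux chain w45b (cell `res-hironaka`, slot W4.5(b)), working crux **EL♮** = stmt-ResolutionOfSingularities-20038, child **EL♮(3)** =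
stmt-ResolutionOfSingularities-20148, route EquisingularLift, rung TOWER (`…NatTowerDefs` p541504 / `TowerRound₀` p547506: downstairs a
cone-witnessed round blows up `Z = E ∩ closure K ⊆ G` and sets `K ↦ closure υ⁻¹(K ∖ Z)`, `E ↦ closure υ⁻¹(E ∖ Z)`, `E_new ↦ υ⁻¹ Z`).
Object named by res-L1-w45b-plan-1 RULING-5 NAMING (b) 2026-08-27T16:37:19Z («CONE-ROUND CLAUSE (4) = SHADOW & EXCEPTIONAL TRANSPORT
THROUGH `coneRound`», carved out of res-D-pv-029's `…NatConeShadowTransport`); parts 1–2 = `…NatConeRoundCartier` (p545368) /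
`…NatConeRoundCentre` (p547344). Hand res-D-pv-051. HONEST FRAMING: OURS; NOT a statement of any manuscript; AI-written, weaker than
expert review. No `sorry`; standard axioms. DEF-FREE. `--supports stmt-ResolutionOfSingularities-20148 --as helper`.

SETTING. A model square `j' ≫ τ = υ ≫ j` which is CARTESIAN (`IsPullback j' υ τ j`: the special fibre `G' = X' ×_X G` of the blown-up
stage), ideal sheaves `I'` on `X'`, `I` on `X` with an iso `e : V(I') ≅ V(I)` OVER `τ` — for the cone round: `I' = St 𝒦, I = 𝒦` by
`coneRound` (p545368), and symmetrically `I' = St 𝓔, I = 𝓔` when `𝒦|_{V(𝓔)}` is Cartier (res-D-pv-029's (F5) «`Z` Cartier on `Ẽ`»).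

* `exists_iso_subscheme_comap_of_iso_over` — (T1) an iso over `τ` passes to the special fibres: `V(I'·𝒪_{G'}) ≅ V(I·𝒪_G)` over `υ`
  (pullback pasting; no blow-up hypothesis);
* `isReduced_subscheme_comap_of_iso_over`, `comap_eq_vanishingIdeal_support_of_iso_over`, `image_support_comap_of_iso_over` — (T2)
  if `I·𝒪_G = 𝓘⟨K̄⟩` is a vanishing ideal sheaf then `I'·𝒪_{G'}` is REDUCED, equals `𝓘⟨its support⟩`, and its support maps onto `K̄`;
* **`support_comap_eq_closure_of_iso_over`**, **`comap_eq_vanishingIdeal_closure_of_iso_over`** — (T3) if moreover `υ` is a blow-up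
  along `𝓘⟨Z⟩` and `Z` is nowhere dense in `K̄` (`K̄ ⊆ closure (K̄ ∖ Z)`), then `supp(I'·𝒪_{G'}) = closure υ⁻¹(K̄ ∖ Z)` and
  **`I'·𝒪_{G'} = 𝓘⟨closure υ⁻¹(K̄ ∖ Z)⟩`** — the `TowerRound₀` bookkeeping `K ↦ closure υ⁻¹(K ∖ Z)`;
* **`coneRound_shadow_comap`** / **`coneRound_exceptional_comap`** — (T3) instantiated through `coneRound` for `St 𝒦` (hypothesis
  `𝓔|_{V(𝒦)}` Cartier) and for `St 𝓔` (hypothesis `𝒦|_{V(𝓔)}` Cartier), centre `𝓔 ⊔ 𝒦` in both;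
* `coneRound_newExceptional_comap` — (T4) the new exceptional divisor's trace `((𝓔 ⊔ 𝒦)·𝒪_{X'})·𝒪_{G'} = (𝓘⟨Z⟩)·𝒪_{G'}` given
  `(𝓔 ⊔ 𝒦)·𝒪_G = 𝓘⟨Z⟩` (`comap_comp`; whether `υ^*𝓘⟨Z⟩` is the REDUCED `𝓘⟨υ⁻¹Z⟩` is downstairs geometry, not claimed here).

References: Görtz–Wedhorn I, Prop. 13.91, (13.19) [GortzWedhorn2020]; Stacks 080E [StacksProject]; tree parts 1–2, `SpreadRestrict`
(`isPullback_subschemeMap`), stub-1's `vanishingIdeal_support_eq_of_isReduced` (…NatInCarrierCentre), `ComponentGluing`, `IsBlowup.isIso_compl`.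
-/

set_option linter.dupNamespace false -- mandated namespace `Summit.<Summit>.<Problem>` of this single-conjunct summit

noncomputable section

open CategoryTheory CategoryTheory.Limits AlgebraicGeometry TopologicalSpace Topology
open Literature.AlgebraicGeometry.Resolution
open AlgebraicGeometry.Scheme.IdealSheafData

namespace Summit.ResolutionOfSingularities.ResolutionOfSingularities.Cruxes.EquisingularLiftNat.Sections

/-! ## (T1) An iso over `τ` passes to the special fibres -/

section FibreIso

variable {X X' G G' : Scheme.{0}} {τ : X' ⟶ X} {j : G ⟶ X} {j' : G' ⟶ X'} {υ : G' ⟶ G}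

/-- **(T1) An isomorphism of closed subschemes over `τ` passes to the special fibres.** If the model square `j' ≫ τ = υ ≫ j` is
cartesian and `e : V(I') ≅ V(I)` is an iso over `τ`, then `V(I'·𝒪_{G'}) ≅ V(I·𝒪_G)` over `υ`: both are `V(I) ×_X G`
(pullback pasting). [folklore; cite: GortzWedhorn2020, (13.19) p. 414] -/
theorem exists_iso_subscheme_comap_of_iso_over (hsq : IsPullback j' υ τ j) (I' : X'.IdealSheafData) (I : X.IdealSheafData)
    (e : I'.subscheme ≅ I.subscheme) (he : e.hom ≫ I.subschemeι = I'.subschemeι ≫ τ) :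
    ∃ eG : (I'.comap j').subscheme ≅ (I.comap j).subscheme,
      eG.hom ≫ (I.comap j).subschemeι = (I'.comap j').subschemeι ≫ υ := by
  have hP₁ := isPullback_subschemeMap j' I'
  have H := hP₁.flip.paste_horiz hsq.flip
  rw [← he] at H
  have E : IsPullback e.hom (e.hom ≫ I.subschemeι) I.subschemeι (𝟙 X) :=
    IsPullback.of_horiz_isIso ⟨by rw [Category.comp_id]⟩
  have H2 := H.flip.paste_horiz E
  rw [Category.comp_id] at H2
  exact ⟨H2.isoIsPullback _ _ (isPullback_subschemeMap j I), by rw [IsPullback.isoIsPullback_hom_snd]⟩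

/-! ## (T2) Reduced special fibre: the trace is the vanishing ideal of its support -/

/-- **(T2a)** In the setting of (T1), if `I·𝒪_G` cuts out a reduced subscheme then so does `I'·𝒪_{G'}`. [folklore] -/
theorem isReduced_subscheme_comap_of_iso_over (hsq : IsPullback j' υ τ j) (I' : X'.IdealSheafData) (I : X.IdealSheafData)
    (e : I'.subscheme ≅ I.subscheme) (he : e.hom ≫ I.subschemeι = I'.subschemeι ≫ τ) [IsReduced (I.comap j).subscheme] :
    IsReduced (I'.comap j').subscheme := by
  obtain ⟨eG, -⟩ := exists_iso_subscheme_comap_of_iso_over hsq I' I e he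
  exact isReduced_of_isOpenImmersion eG.hom

/-- **(T2b)** In the setting of (T1), if `I·𝒪_G = 𝓘⟨K̄⟩` is the vanishing ideal sheaf of a closed set, then the trace `I'·𝒪_{G'}` is
the vanishing ideal sheaf of its own support (it is reduced). [folklore] -/
theorem comap_eq_vanishingIdeal_support_of_iso_over (hsq : IsPullback j' υ τ j) (I' : X'.IdealSheafData) (I : X.IdealSheafData)
    (e : I'.subscheme ≅ I.subscheme) (he : e.hom ≫ I.subschemeι = I'.subschemeι ≫ τ) (Kc : Closeds G)
    (hI : I.comap j = vanishingIdeal Kc) :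
    I'.comap j' = vanishingIdeal (I'.comap j').support := by
  haveI : IsReduced (I.comap j).subscheme := by
    rw [hI]; exact ComponentGluing.isReduced_subscheme_vanishingIdeal Kc
  haveI := isReduced_subscheme_comap_of_iso_over hsq I' I e he
  exact (vanishingIdeal_support_eq_of_isReduced (I'.comap j')).symm

/-- **(T2c)** In the setting of (T1), `υ` maps the support of `I'·𝒪_{G'}` ONTO the support of `I·𝒪_G`. [folklore] -/
theorem image_support_comap_of_iso_over (hsq : IsPullback j' υ τ j) (I' : X'.IdealSheafData) (I : X.IdealSheafData)
    (e : I'.subscheme ≅ I.subscheme) (he : e.hom ≫ I.subschemeι = I'.subschemeι ≫ τ) :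
    υ '' ((I'.comap j').support : Set G') = ((I.comap j).support : Set G) := by
  obtain ⟨eG, heG⟩ := exists_iso_subscheme_comap_of_iso_over hsq I' I e he
  rw [← range_subschemeι, ← range_subschemeι, ← Set.range_comp]
  have h : υ ∘ (I'.comap j').subschemeι = ((I'.comap j').subschemeι ≫ υ : _ ⟶ G) := by
    ext x; rw [Function.comp_apply, Scheme.Hom.comp_apply]
  have hsurj : Function.Surjective eG.hom.base := eG.hom.homeomorph.surjective
  rw [h, ← heG, Scheme.Hom.comp_base, TopCat.coe_comp, Set.range_comp, hsurj.range_eq, Set.image_univ]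

/-! ## (T3) The support is the topological strict transform -/

/-- A blow-up is injective off its centre (it restricts to an isomorphism over the complement of the centre).
[cite: GortzWedhorn2020, Prop. 13.91 (3)] -/
theorem eq_of_apply_eq_of_not_mem_of_isBlowup {J : G.IdealSheafData} (hυ : IsBlowup υ J) {p q : G'}
    (hpq : υ p = υ q) (hp : υ p ∉ (J.support : Set G)) : p = q := by
  let U : G.Opens := ⟨(J.support : Set G)ᶜ, J.support.isClosed.isOpen_compl⟩
  haveI : IsIso (υ ∣_ U) := hυ.isIso_compl
  have hpU : p ∈ υ ⁻¹ᵁ U := hp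
  have hqU : q ∈ υ ⁻¹ᵁ U := by change υ q ∈ U; rw [← hpq]; exact hp
  have hinj : Function.Injective (υ ∣_ U) := (υ ∣_ U).homeomorph.injective
  have key : (υ ∣_ U) ⟨p, hpU⟩ = (υ ∣_ U) ⟨q, hqU⟩ := by
    apply Subtype.ext
    rw [morphismRestrict_base_coe, morphismRestrict_base_coe]
    exact hpq
  exact congrArg Subtype.val (hinj key)

/-- **(T3a) The support of the trace is the topological strict transform.** In the setting of (T1) with `I·𝒪_G = 𝓘⟨K̄⟩`, if `υ` is a
blow-up along `𝓘⟨Z⟩` and `Z` is nowhere dense in `K̄` (`K̄ ⊆ closure (K̄ ∖ Z)`), then `supp(I'·𝒪_{G'}) = closure υ⁻¹(K̄ ∖ Z)`.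
[cite: GortzWedhorn2020, (13.19) p. 414] -/
theorem support_comap_eq_closure_of_iso_over (hsq : IsPullback j' υ τ j) (I' : X'.IdealSheafData) (I : X.IdealSheafData)
    (e : I'.subscheme ≅ I.subscheme) (he : e.hom ≫ I.subschemeι = I'.subschemeι ≫ τ) (Kc Zc : Closeds G)
    (hI : I.comap j = vanishingIdeal Kc) (hυ : IsBlowup υ (vanishingIdeal Zc))
    (hdense : (Kc : Set G) ⊆ closure ((Kc : Set G) \ Zc)) :
    ((I'.comap j').support : Set G') = closure (υ ⁻¹' ((Kc : Set G) \ Zc)) := by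
  obtain ⟨eG, heG⟩ := exists_iso_subscheme_comap_of_iso_over hsq I' I e he
  have hsuppI : ((I.comap j).support : Set G) = Kc := by rw [hI, coe_support_vanishingIdeal]
  have himage := image_support_comap_of_iso_over hsq I' I e he
  rw [hsuppI] at himage
  -- `⊇`: a point over `K̄ ∖ Z` has a companion in the support with the same image; off `Z`, `υ` is injective
  have hsub : υ ⁻¹' ((Kc : Set G) \ Zc) ⊆ ((I'.comap j').support : Set G') := by
    intro q hq
    obtain ⟨p, hp, hpq⟩ : υ q ∈ υ '' ((I'.comap j').support : Set G') := by rw [himage]; exact hq.1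
    have hpZ : υ p ∉ ((vanishingIdeal Zc).support : Set G) := by
      rw [coe_support_vanishingIdeal, hpq]; exact hq.2
    rwa [← eq_of_apply_eq_of_not_mem_of_isBlowup hυ hpq hpZ]
  refine Set.Subset.antisymm ?_ ((I'.comap j').support.isClosed.closure_subset_iff.mpr hsub)
  -- `⊆`: the support is the image of `V(I·𝒪_G) = K̄_red` under the closed embedding `σ = eG⁻¹ ≫ ι`, and `K̄ ∖ Z` is dense in `K̄`
  rw [← range_subschemeι]
  rintro _ ⟨x, rfl⟩
  -- write `x = eG.inv y`
  obtain ⟨y, rfl⟩ : ∃ y, eG.inv y = x := ⟨eG.hom x, by rw [← Scheme.Hom.comp_apply, eG.hom_inv_id]; rfl⟩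
  -- density of `ι₀⁻¹(K̄ ∖ Z)` in `V(I·𝒪_G)`
  have hι₀ : Set.range (I.comap j).subschemeι = (Kc : Set G) := by rw [range_subschemeι, hsuppI]
  have hdense' : y ∈ closure ((I.comap j).subschemeι ⁻¹' ((Kc : Set G) \ Zc)) := by
    rw [(I.comap j).subschemeι.isClosedEmbedding.isInducing.closure_eq_preimage_closure_image,
      Set.image_preimage_eq_inter_range, hι₀, Set.inter_eq_left.mpr Set.sdiff_subset]
    exact hdense (hι₀ ▸ Set.mem_range_self y)
  -- push forward along the continuous map `σ = eG.inv ≫ ι₁`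
  have hcont : Continuous fun z => (I'.comap j').subschemeι (eG.inv z) := (eG.inv ≫ (I'.comap j').subschemeι).continuous
  have hmem := map_mem_closure hcont hdense' (t := υ ⁻¹' ((Kc : Set G) \ Zc)) (fun z hz => ?_)
  · exact hmem
  · -- `υ (ι₁ (eG.inv z)) = ι₀ z ∈ K̄ ∖ Z`
    change υ ((I'.comap j').subschemeι (eG.inv z)) ∈ (Kc : Set G) \ Zc
    rw [← Scheme.Hom.comp_apply, ← Scheme.Hom.comp_apply, ← heG, eG.inv_hom_id_assoc]
    exact hz

/-- **(T3b) THE TRACE IS THE VANISHING IDEAL OF THE TOPOLOGICAL STRICT TRANSFORM.** In the setting of (T3a):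
`I'·𝒪_{G'} = 𝓘⟨closure υ⁻¹(K̄ ∖ Z)⟩`. [cite: GortzWedhorn2020, (13.19) p. 414] [OURS · L1 W4.5b] -/
theorem comap_eq_vanishingIdeal_closure_of_iso_over (hsq : IsPullback j' υ τ j) (I' : X'.IdealSheafData) (I : X.IdealSheafData)
    (e : I'.subscheme ≅ I.subscheme) (he : e.hom ≫ I.subschemeι = I'.subschemeι ≫ τ) (Kc Zc : Closeds G)
    (hI : I.comap j = vanishingIdeal Kc) (hυ : IsBlowup υ (vanishingIdeal Zc))
    (hdense : (Kc : Set G) ⊆ closure ((Kc : Set G) \ Zc)) :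
    I'.comap j' = vanishingIdeal (⟨closure (υ ⁻¹' ((Kc : Set G) \ Zc)), isClosed_closure⟩ : Closeds G') := by
  rw [comap_eq_vanishingIdeal_support_of_iso_over hsq I' I e he Kc hI]
  congr 1
  exact Closeds.ext (support_comap_eq_closure_of_iso_over hsq I' I e he Kc Zc hI hυ hdense)

end FibreIso

/-! ## (T3)/(T4) through the cone round -/

section ConeRound

variable {X X' G G' : Scheme.{0}} [IsLocallyNoetherian X] (𝓔 𝒦 : X.IdealSheafData) {τ : X' ⟶ X} {j : G ⟶ X}
  {j' : G' ⟶ X'} {υ : G' ⟶ G}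

omit [IsLocallyNoetherian X] in
/-- Clause (1) of the cone round for the FIRST summand: if `𝒦|_{V(𝓔)}` is an effective Cartier divisor (res-D-pv-029's (F5): «`Z` is
Cartier on `Ẽ`»), the strict transform of `V(𝓔)` under the blow-up along `𝓔 ⊔ 𝒦` IS `V(𝓔)`. [cite: GortzWedhorn2020, (13.19) p. 413] -/
theorem exists_iso_subscheme_strictTransformIdeal_exceptional [IsLocallyNoetherian X] (hK𝓔 : IsEffectiveCartier (𝒦.comap 𝓔.subschemeι))
    (hτ : IsBlowup τ (𝓔 ⊔ 𝒦)) :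
    ∃ e : (strictTransformIdeal τ (𝓔 ⊔ 𝒦) 𝓔).subscheme ≅ 𝓔.subscheme,
      e.hom ≫ 𝓔.subschemeι = (strictTransformIdeal τ (𝓔 ⊔ 𝒦) 𝓔).subschemeι ≫ τ := by
  have h := nonempty_iso_subscheme_strictTransformIdeal_cone 𝒦 𝓔 hK𝓔 (by rwa [sup_comm])
  rwa [sup_comm] at h

/-- **CONE ROUND, CLAUSE (4) FOR THE SHADOW: `(St 𝒦)·𝒪_{G'} = 𝓘⟨closure υ⁻¹(K̄ ∖ Z)⟩`.** Blow-up `τ` along `𝓔 ⊔ 𝒦` with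
`𝓔|_{V(𝒦)}` Cartier; cartesian model square `j' ≫ τ = υ ≫ j` with `υ` a blow-up along `𝓘⟨Z⟩`; shadow trace `𝒦·𝒪_G = 𝓘⟨K̄⟩` with `Z`
nowhere dense in `K̄`. [cite: GortzWedhorn2020, Prop. 13.91 and (13.19)] [OURS · L1 W4.5b] rung TOWER supplier; NOT a statement of
the manuscript. -/
theorem coneRound_shadow_comap (hE𝒦 : IsEffectiveCartier (𝓔.comap 𝒦.subschemeι)) (hτ : IsBlowup τ (𝓔 ⊔ 𝒦))
    (hsq : IsPullback j' υ τ j) (Kc Zc : Closeds G) (hK : 𝒦.comap j = vanishingIdeal Kc) (hυ : IsBlowup υ (vanishingIdeal Zc))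
    (hdense : (Kc : Set G) ⊆ closure ((Kc : Set G) \ Zc)) :
    (strictTransformIdeal τ (𝓔 ⊔ 𝒦) 𝒦).comap j' =
      vanishingIdeal (⟨closure (υ ⁻¹' ((Kc : Set G) \ Zc)), isClosed_closure⟩ : Closeds G') := by
  obtain ⟨e, he⟩ := nonempty_iso_subscheme_strictTransformIdeal_cone 𝓔 𝒦 hE𝒦 hτ
  exact comap_eq_vanishingIdeal_closure_of_iso_over hsq _ _ e he Kc Zc hK hυ hdense

/-- **CONE ROUND, CLAUSE (4) FOR THE OLD EXCEPTIONAL SURFACE: `(St 𝓔)·𝒪_{G'} = 𝓘⟨closure υ⁻¹(E ∖ Z)⟩`**, under res-D-pv-029's (F5)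
hypothesis that `𝒦|_{V(𝓔)}` is Cartier («`Z` Cartier on `Ẽ`»), with `𝓔·𝒪_G = 𝓘⟨E⟩` and `Z` nowhere dense in `E`.
[cite: GortzWedhorn2020, Prop. 13.91 and (13.19)] [OURS · L1 W4.5b] -/
theorem coneRound_exceptional_comap (hK𝓔 : IsEffectiveCartier (𝒦.comap 𝓔.subschemeι)) (hτ : IsBlowup τ (𝓔 ⊔ 𝒦))
    (hsq : IsPullback j' υ τ j) (Ec Zc : Closeds G) (hE : 𝓔.comap j = vanishingIdeal Ec) (hυ : IsBlowup υ (vanishingIdeal Zc))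
    (hdense : (Ec : Set G) ⊆ closure ((Ec : Set G) \ Zc)) :
    (strictTransformIdeal τ (𝓔 ⊔ 𝒦) 𝓔).comap j' =
      vanishingIdeal (⟨closure (υ ⁻¹' ((Ec : Set G) \ Zc)), isClosed_closure⟩ : Closeds G') := by
  obtain ⟨e, he⟩ := exists_iso_subscheme_strictTransformIdeal_exceptional 𝓔 𝒦 hK𝓔 hτ
  exact comap_eq_vanishingIdeal_closure_of_iso_over hsq _ _ e he Ec Zc hE hυ hdense

omit [IsLocallyNoetherian X] in
/-- **(T4) The new exceptional divisor's trace** is the pull-back of the old centre's trace: if `(𝓔 ⊔ 𝒦)·𝒪_G = 𝓘⟨Z⟩` then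
`((𝓔 ⊔ 𝒦)·𝒪_{X'})·𝒪_{G'} = υ^*𝓘⟨Z⟩`. (Set-theoretically `υ⁻¹ Z`; reducedness of `υ^*𝓘⟨Z⟩` is NOT claimed.) [folklore] -/
theorem coneRound_newExceptional_comap (hcomm : j' ≫ τ = υ ≫ j) (Zc : Closeds G) (hZ : (𝓔 ⊔ 𝒦).comap j = vanishingIdeal Zc) :
    ((𝓔 ⊔ 𝒦).comap τ).comap j' = (vanishingIdeal Zc).comap υ := by
  rw [← Scheme.IdealSheafData.comap_comp, hcomm, Scheme.IdealSheafData.comap_comp, hZ]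

omit [IsLocallyNoetherian X] in
/-- (T4, support form) `supp(((𝓔 ⊔ 𝒦)·𝒪_{X'})·𝒪_{G'}) = υ⁻¹ Z`. [folklore] -/
theorem support_coneRound_newExceptional_comap (hcomm : j' ≫ τ = υ ≫ j) (Zc : Closeds G)
    (hZ : (𝓔 ⊔ 𝒦).comap j = vanishingIdeal Zc) :
    ((((𝓔 ⊔ 𝒦).comap τ).comap j').support : Set G') = υ ⁻¹' (Zc : Set G) := by
  rw [coneRound_newExceptional_comap 𝓔 𝒦 hcomm Zc hZ, support_comap, Closeds.coe_preimage, coe_support_vanishingIdeal]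

end ConeRound

end Summit.ResolutionOfSingularities.ResolutionOfSingularities.Cruxes.EquisingularLiftNat.Sections

end
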